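import Mathlib
import Literature.MathematicalPhysics.StatisticalMechanics.OneCrossingMixture
import Summits.AtomisticToContinuum.Crystallization.Theorems.ThreeConeCertificateExactCertificateTransfer1DClassBounds

/-!
# Crux `ExactCertificate` (stmt-AtomisticToContinuum-11959), line `closure-makes-nogap-exact`,
# Transfer skeleton VII (`OneCrossingChainCrystallizes`): stub `stub_chainEnergy_signs`

Support file for the crux `ThreeConeCertificate.ExactCertificate`, d = 1 Transfer skeleton VII
`Cruxes.ExactCertificate.Transfer1D.OneCrossingChainCrystallizes` (zero pressure EXISTS for a pair
potential `V(r) = −∫₀^∞ e^{−tr} p(t) dt` of the one-crossing Laplace class: `p ≥ 0` on `(0, t₀]`,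
`p ≤ 0` on `[t₀, ∞)`, `|p(t)| ≤ C (t² + t^M)`, `M ≥ 2`).  This file proves the registered stub
`stub_chainEnergy_signs`, the four SIGN FACTS of such a potential:

* `zsign_lower_bound` — (i) `V ≥ −B` on `(0, ∞)`: pointwise `e^{−tr} p(t) ≤ C (t₀² + t₀^M) e^{t₀} e^{−t}`
  (drop the attractive part `t ≥ t₀` of the density, bound the repulsive part by the envelope);
* `zsign_neg_propagates` — (ii) negativity propagates to the right: the tilted transform
  `r ↦ e^{t₀ r} ∫₀^∞ e^{−tr} p(t) dt = ∫₀^∞ e^{(t₀ − t) r} p(t) dt` is non-decreasing on `(0, ∞)`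
  (the integrand is pointwise non-decreasing in `r`: `t₀ − t` and `p t` have the same sign), so
  `V r₁ < 0`, `r₁ ≤ r` give `V r < 0`;
* `zsign_chain_neg` — (iii) hence the chain energy `Σ_k V((k+1) r₁)` is negative whenever `V r₁ < 0`;
* `zsign_chain_tendsto_zero` — (iv) the chain energy tends to `0` at infinity:
  `|Σ_k V((k+1) b)| ≤ C (2 + M!) ζ(3) b⁻¹` for `b ≥ 1` (from `|V(r)| ≤ C (2 r⁻³ + M! r^{−(M+1)})`).

All `[folklore]` (elementary Laplace-transform bookkeeping); the envelope consequences are imported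
from `…Transfer1DClassBounds`.
-/

noncomputable section

namespace Summit.AtomisticToContinuum.Crystallization.Theorems.ThreeConeCertificateExactCertificate.Transfer1D

open Literature.MathematicalPhysics.StatisticalMechanics MeasureTheory Set Filter Topology
open scoped BigOperators

/-! ## (i) The lower bound -/

/-- **Pointwise majorant.** For `p ≥ 0` on `(0, t₀]`, `p ≤ 0` on `[t₀, ∞)` under the envelope
`|p(t)| ≤ C (t² + t^M)`, for `r > 0` and `t > 0`:
`e^{−tr} p(t) ≤ C (t₀² + t₀^M) e^{t₀} e^{−t}` (for `t ≤ t₀` the left side is `≤ p t ≤ C (t₀² + t₀^M)`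
and `e^{t₀ − t} ≥ 1`; for `t ≥ t₀` it is `≤ 0`). [folklore] -/
theorem zsign_integrand_le {p : ℝ → ℝ} {t₀ C : ℝ} {M : ℕ} (ht₀ : 0 < t₀)
    (hpos : ∀ t : ℝ, 0 < t → t ≤ t₀ → 0 ≤ p t) (hneg : ∀ t : ℝ, t₀ ≤ t → p t ≤ 0)
    (hbd : ∀ t : ℝ, 0 < t → |p t| ≤ C * (t ^ 2 + t ^ M)) {r : ℝ} (hr : 0 < r) {t : ℝ}
    (ht : 0 < t) :
    Real.exp (-(t * r)) * p t ≤ C * (t₀ ^ 2 + t₀ ^ M) * Real.exp t₀ * Real.exp (-t) := by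
  have hC := classBounds_C_nonneg hbd
  have ht₀' : 0 ≤ t₀ := ht₀.le
  have hK : 0 ≤ C * (t₀ ^ 2 + t₀ ^ M) := by positivity
  rcases le_total t t₀ with hle | hle
  · -- below the crossing: `0 ≤ p t ≤ C (t² + t^M) ≤ C (t₀² + t₀^M)` and `e^{-tr} ≤ 1 ≤ e^{t₀} e^{-t}`
    have he1 : Real.exp (-(t * r)) ≤ 1 :=
      Real.exp_le_one_iff.2 (neg_nonpos.2 (mul_pos ht hr).le)
    have hp0 : 0 ≤ p t := hpos t ht hle
    have h1 : Real.exp (-(t * r)) * p t ≤ p t := mul_le_of_le_one_left hp0 he1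
    have h2 : p t ≤ C * (t ^ 2 + t ^ M) := (le_abs_self _).trans (hbd t ht)
    have h3 : C * (t ^ 2 + t ^ M) ≤ C * (t₀ ^ 2 + t₀ ^ M) := by
      have h2' := pow_le_pow_left₀ ht.le hle 2
      have hM' := pow_le_pow_left₀ ht.le hle M
      exact mul_le_mul_of_nonneg_left (add_le_add h2' hM') hC
    have h4 : 1 ≤ Real.exp t₀ * Real.exp (-t) := by
      rw [← Real.exp_add]
      exact Real.one_le_exp (by linarith)
    calc Real.exp (-(t * r)) * p t ≤ C * (t₀ ^ 2 + t₀ ^ M) := h1.trans (h2.trans h3)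
      _ ≤ C * (t₀ ^ 2 + t₀ ^ M) * (Real.exp t₀ * Real.exp (-t)) := le_mul_of_one_le_right hK h4
      _ = C * (t₀ ^ 2 + t₀ ^ M) * Real.exp t₀ * Real.exp (-t) := by ring
  · -- above the crossing: the left side is `≤ 0`
    have h1 : Real.exp (-(t * r)) * p t ≤ 0 :=
      mul_nonpos_of_nonneg_of_nonpos (Real.exp_pos _).le (hneg t hle)
    have h2 : 0 ≤ C * (t₀ ^ 2 + t₀ ^ M) * Real.exp t₀ * Real.exp (-t) := by positivity
    exact h1.trans h2

/-- **(i) Lower bound.** `V(r) = −∫₀^∞ e^{−tr} p(t) dt ≥ −B` for all `r > 0`, with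
`B = ∫₀^∞ C (t₀² + t₀^M) e^{t₀} e^{−t} dt` (integrate `zsign_integrand_le`). [folklore] -/
theorem zsign_lower_bound {V p : ℝ → ℝ} {t₀ C : ℝ} {M : ℕ} (hpm : Measurable p) (ht₀ : 0 < t₀)
    (hpos : ∀ t : ℝ, 0 < t → t ≤ t₀ → 0 ≤ p t) (hneg : ∀ t : ℝ, t₀ ≤ t → p t ≤ 0)
    (hbd : ∀ t : ℝ, 0 < t → |p t| ≤ C * (t ^ 2 + t ^ M))
    (hV : ∀ r : ℝ, 0 < r → V r = -(∫ t in Set.Ioi (0 : ℝ), Real.exp (-(t * r)) * p t)) :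
    ∃ B : ℝ, ∀ r : ℝ, 0 < r → -B ≤ V r := by
  refine ⟨∫ t in Ioi (0 : ℝ), C * (t₀ ^ 2 + t₀ ^ M) * Real.exp t₀ * Real.exp (-t), fun r hr => ?_⟩
  rw [hV r hr, neg_le_neg_iff]
  have hg : IntegrableOn (fun t : ℝ => C * (t₀ ^ 2 + t₀ ^ M) * Real.exp t₀ * Real.exp (-t)) (Ioi 0) :=
    (integrableOn_exp_neg_Ioi 0).const_mul (C * (t₀ ^ 2 + t₀ ^ M) * Real.exp t₀)
  exact setIntegral_mono_on (classBounds_integrableOn_zero hpm hbd hr) hg measurableSet_Ioi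
    fun t ht => zsign_integrand_le ht₀ hpos hneg hbd hr ht

/-! ## (ii) Negativity propagates to the right -/

/-- **Pointwise monotonicity of the tilted integrand.** For `p ≥ 0` on `(0, t₀]`, `p ≤ 0` on
`[t₀, ∞)`, `r₁ ≤ r` and `t > 0`:
`0 ≤ e^{t₀ r} (e^{−tr} p(t)) − e^{t₀ r₁} (e^{−t r₁} p(t)) = (e^{(t₀−t) r} − e^{(t₀−t) r₁}) p(t)`
(both factors have the sign of `t₀ − t`). [folklore] -/
theorem zsign_tilt_sub_nonneg {p : ℝ → ℝ} {t₀ : ℝ}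
    (hpos : ∀ t : ℝ, 0 < t → t ≤ t₀ → 0 ≤ p t) (hneg : ∀ t : ℝ, t₀ ≤ t → p t ≤ 0)
    {r₁ r : ℝ} (hr : r₁ ≤ r) {t : ℝ} (ht : 0 < t) :
    0 ≤ Real.exp (t₀ * r) * (Real.exp (-(t * r)) * p t)
      - Real.exp (t₀ * r₁) * (Real.exp (-(t * r₁)) * p t) := by
  have e : ∀ s : ℝ, Real.exp (t₀ * s) * (Real.exp (-(t * s)) * p t)
      = Real.exp ((t₀ - t) * s) * p t := by
    intro s
    rw [← mul_assoc, ← Real.exp_add, show t₀ * s + -(t * s) = (t₀ - t) * s by ring]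
  rw [e, e, ← sub_mul]
  rcases le_total t t₀ with hle | hle
  · have h1 : (t₀ - t) * r₁ ≤ (t₀ - t) * r := mul_le_mul_of_nonneg_left hr (sub_nonneg.2 hle)
    exact mul_nonneg (sub_nonneg.2 (Real.exp_le_exp.2 h1)) (hpos t ht hle)
  · have h1 : (t₀ - t) * r ≤ (t₀ - t) * r₁ := mul_le_mul_of_nonpos_left hr (sub_nonpos.2 hle)
    exact mul_nonneg_of_nonpos_of_nonpos (sub_nonpos.2 (Real.exp_le_exp.2 h1)) (hneg t hle)

/-- **(ii) Negativity propagates.** With `V(r) = −∫₀^∞ e^{−tr} p(t) dt`, `p` one-crossing at `t₀` and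
the envelope (for integrability): `0 < r₁ ≤ r`, `V r₁ < 0 ⟹ V r < 0`, because
`e^{t₀ r} ∫ e^{−tr} p ≥ e^{t₀ r₁} ∫ e^{−t r₁} p > 0` (integrate `zsign_tilt_sub_nonneg`). [folklore] -/
theorem zsign_neg_propagates {V p : ℝ → ℝ} {t₀ C : ℝ} {M : ℕ} (hpm : Measurable p)
    (hpos : ∀ t : ℝ, 0 < t → t ≤ t₀ → 0 ≤ p t) (hneg : ∀ t : ℝ, t₀ ≤ t → p t ≤ 0)
    (hbd : ∀ t : ℝ, 0 < t → |p t| ≤ C * (t ^ 2 + t ^ M))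
    (hV : ∀ r : ℝ, 0 < r → V r = -(∫ t in Set.Ioi (0 : ℝ), Real.exp (-(t * r)) * p t))
    {r₁ r : ℝ} (hr₁ : 0 < r₁) (hr : r₁ ≤ r) (hV₁ : V r₁ < 0) : V r < 0 := by
  have hr0 : 0 < r := hr₁.trans_le hr
  have hi₁ : Integrable (fun t : ℝ => Real.exp (t₀ * r₁) * (Real.exp (-(t * r₁)) * p t))
      (volume.restrict (Ioi 0)) :=
    (classBounds_integrableOn_zero hpm hbd hr₁).const_mul (Real.exp (t₀ * r₁))
  have hi : Integrable (fun t : ℝ => Real.exp (t₀ * r) * (Real.exp (-(t * r)) * p t))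
      (volume.restrict (Ioi 0)) :=
    (classBounds_integrableOn_zero hpm hbd hr0).const_mul (Real.exp (t₀ * r))
  rw [hV r₁ hr₁, neg_lt_zero] at hV₁
  rw [hV r hr0, neg_lt_zero]
  have hdiff : 0 ≤ ∫ t in Ioi (0 : ℝ), (Real.exp (t₀ * r) * (Real.exp (-(t * r)) * p t)
      - Real.exp (t₀ * r₁) * (Real.exp (-(t * r₁)) * p t)) :=
    setIntegral_nonneg measurableSet_Ioi fun t ht => zsign_tilt_sub_nonneg hpos hneg hr ht
  rw [integral_sub hi hi₁, integral_const_mul, integral_const_mul] at hdiff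
  have h1 : 0 < Real.exp (t₀ * r₁) * ∫ t in Ioi (0 : ℝ), Real.exp (-(t * r₁)) * p t :=
    mul_pos (Real.exp_pos _) hV₁
  have h2 : 0 < Real.exp (t₀ * r) * ∫ t in Ioi (0 : ℝ), Real.exp (-(t * r)) * p t := by
    linarith
  exact pos_of_mul_pos_right h2 (Real.exp_pos _).le

/-! ## (iii) The chain energy at an attractive spacing is negative -/

/-- **(iii) Negative chain energy.** If `V r₁ < 0` (`r₁ > 0`) then `Σ_k V((k+1) r₁) < 0`: every term is
negative by `zsign_neg_propagates` (`(k+1) r₁ ≥ r₁`) and the series converges (`classBounds_summable`).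
[folklore] -/
theorem zsign_chain_neg {V p : ℝ → ℝ} {t₀ C : ℝ} {M : ℕ} (hM : 2 ≤ M) (hpm : Measurable p)
    (hpos : ∀ t : ℝ, 0 < t → t ≤ t₀ → 0 ≤ p t) (hneg : ∀ t : ℝ, t₀ ≤ t → p t ≤ 0)
    (hbd : ∀ t : ℝ, 0 < t → |p t| ≤ C * (t ^ 2 + t ^ M))
    (hV : ∀ r : ℝ, 0 < r → V r = -(∫ t in Set.Ioi (0 : ℝ), Real.exp (-(t * r)) * p t))
    {r₁ : ℝ} (hr₁ : 0 < r₁) (hV₁ : V r₁ < 0) :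
    ∑' k : ℕ, V (((k : ℝ) + 1) * r₁) < 0 := by
  have hs : Summable (fun k : ℕ => V (((k : ℝ) + 1) * r₁)) := by
    have h := classBounds_summable hM hpm hbd hV hr₁ (le_refl (0 : ℝ))
    simpa only [zero_add] using h
  have hterm : ∀ k : ℕ, V (((k : ℝ) + 1) * r₁) < 0 := fun k => by
    have hk : (1 : ℝ) ≤ (k : ℝ) + 1 := by
      have := k.cast_nonneg (α := ℝ)
      linarith
    exact zsign_neg_propagates hpm hpos hneg hbd hV hr₁ (le_mul_of_one_le_left hr₁.le hk) hV₁
  have h := hasSum_lt (f := fun k : ℕ => V (((k : ℝ) + 1) * r₁)) (g := fun _ : ℕ => (0 : ℝ))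
    (i := 0) (fun k => (hterm k).le) (hterm 0) hs.hasSum hasSum_zero
  exact h

/-! ## (iv) The chain energy vanishes at infinity -/

/-- **Termwise decay for `b ≥ 1`.** `|V((k+1) b)| ≤ C (2 + M!) b⁻¹ (k+1)⁻³`: with `x = (k+1) b ≥ 1`,
`|V x| ≤ C (2 x⁻³ + M! x^{−(M+1)}) ≤ C (2 + M!) x⁻³ = C (2 + M!) (k+1)⁻³ b⁻³ ≤ C (2 + M!) (k+1)⁻³ b⁻¹`.
[folklore] -/
theorem zsign_abs_le_of_one_le {V p : ℝ → ℝ} {C : ℝ} {M : ℕ} (hM : 2 ≤ M) (hpm : Measurable p)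
    (hbd : ∀ t : ℝ, 0 < t → |p t| ≤ C * (t ^ 2 + t ^ M))
    (hV : ∀ r : ℝ, 0 < r → V r = -(∫ t in Set.Ioi (0 : ℝ), Real.exp (-(t * r)) * p t))
    {b : ℝ} (hb : 1 ≤ b) (k : ℕ) :
    ‖V (((k : ℝ) + 1) * b)‖ ≤ C * (2 + (M.factorial : ℝ)) * b⁻¹ * ((k : ℝ) + 1)⁻¹ ^ 3 := by
  have hC := classBounds_C_nonneg hbd
  have hk1 : (1 : ℝ) ≤ (k : ℝ) + 1 := by
    have := k.cast_nonneg (α := ℝ)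
    linarith
  have hb0 : 0 < b := one_pos.trans_le hb
  have hx1 : 1 ≤ ((k : ℝ) + 1) * b := one_le_mul_of_one_le_of_one_le hk1 hb
  have hx0 : 0 < ((k : ℝ) + 1) * b := one_pos.trans_le hx1
  have hxi0 : 0 ≤ (((k : ℝ) + 1) * b)⁻¹ := inv_nonneg.2 hx0.le
  have hxi1 : (((k : ℝ) + 1) * b)⁻¹ ≤ 1 := inv_le_one_of_one_le₀ hx1
  have h1 := classBounds_abs_le hpm hbd hV hx0
  have h2 : (((k : ℝ) + 1) * b)⁻¹ ^ (M + 1) ≤ (((k : ℝ) + 1) * b)⁻¹ ^ 3 :=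
    pow_le_pow_of_le_one hxi0 hxi1 (by omega)
  have h3 : (((k : ℝ) + 1) * b)⁻¹ ^ 3 = ((k : ℝ) + 1)⁻¹ ^ 3 * b⁻¹ ^ 3 := by
    rw [mul_inv, mul_pow]
  have hbi0 : 0 ≤ b⁻¹ := inv_nonneg.2 hb0.le
  have hb3 : b⁻¹ ^ 3 ≤ b⁻¹ := pow_le_of_le_one hbi0 (inv_le_one_of_one_le₀ hb) (by norm_num)
  have hf : (0 : ℝ) ≤ M.factorial := Nat.cast_nonneg _
  have hk3 : 0 ≤ ((k : ℝ) + 1)⁻¹ ^ 3 := pow_nonneg (inv_nonneg.2 (zero_le_one.trans hk1)) 3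
  have hK : 0 ≤ C * (2 + (M.factorial : ℝ)) * ((k : ℝ) + 1)⁻¹ ^ 3 := by positivity
  rw [Real.norm_eq_abs]
  calc |V (((k : ℝ) + 1) * b)|
      ≤ C * (2 * (((k : ℝ) + 1) * b)⁻¹ ^ 3 + (M.factorial : ℝ) * (((k : ℝ) + 1) * b)⁻¹ ^ (M + 1)) := h1
    _ ≤ C * (2 * (((k : ℝ) + 1) * b)⁻¹ ^ 3 + (M.factorial : ℝ) * (((k : ℝ) + 1) * b)⁻¹ ^ 3) :=
        mul_le_mul_of_nonneg_left (by nlinarith) hC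
    _ = C * (2 + (M.factorial : ℝ)) * ((k : ℝ) + 1)⁻¹ ^ 3 * b⁻¹ ^ 3 := by rw [h3]; ring
    _ ≤ C * (2 + (M.factorial : ℝ)) * ((k : ℝ) + 1)⁻¹ ^ 3 * b⁻¹ := mul_le_mul_of_nonneg_left hb3 hK
    _ = C * (2 + (M.factorial : ℝ)) * b⁻¹ * ((k : ℝ) + 1)⁻¹ ^ 3 := by ring

/-- **(iv) The chain energy tends to `0` at infinity**: for `b ≥ 1`,
`|Σ_k V((k+1) b)| ≤ (C (2 + M!) Σ_k (k+1)⁻³) b⁻¹ → 0` (`zsign_abs_le_of_one_le`, `tsum_of_norm_bounded`).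
[folklore] -/
theorem zsign_chain_tendsto_zero {V p : ℝ → ℝ} {C : ℝ} {M : ℕ} (hM : 2 ≤ M) (hpm : Measurable p)
    (hbd : ∀ t : ℝ, 0 < t → |p t| ≤ C * (t ^ 2 + t ^ M))
    (hV : ∀ r : ℝ, 0 < r → V r = -(∫ t in Set.Ioi (0 : ℝ), Real.exp (-(t * r)) * p t)) :
    Tendsto (fun b : ℝ => ∑' k : ℕ, V (((k : ℝ) + 1) * b)) atTop (𝓝 0) := by
  have hS : Summable (fun k : ℕ => ((k : ℝ) + 1)⁻¹ ^ 3) :=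
    classBounds_summable_inv_pow (by norm_num : 2 ≤ 3)
  refine squeeze_zero_norm'
    (a := fun b : ℝ => (C * (2 + (M.factorial : ℝ)) * ∑' k : ℕ, ((k : ℝ) + 1)⁻¹ ^ 3) * b⁻¹) ?_ ?_
  · filter_upwards [eventually_ge_atTop (1 : ℝ)] with b hb
    have hsum : HasSum (fun k : ℕ => C * (2 + (M.factorial : ℝ)) * b⁻¹ * ((k : ℝ) + 1)⁻¹ ^ 3)
        (C * (2 + (M.factorial : ℝ)) * b⁻¹ * ∑' k : ℕ, ((k : ℝ) + 1)⁻¹ ^ 3) :=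
      hS.hasSum.mul_left _
    have h := tsum_of_norm_bounded hsum fun k => zsign_abs_le_of_one_le hM hpm hbd hV hb k
    calc ‖∑' k : ℕ, V (((k : ℝ) + 1) * b)‖
        ≤ C * (2 + (M.factorial : ℝ)) * b⁻¹ * ∑' k : ℕ, ((k : ℝ) + 1)⁻¹ ^ 3 := h
      _ = (C * (2 + (M.factorial : ℝ)) * ∑' k : ℕ, ((k : ℝ) + 1)⁻¹ ^ 3) * b⁻¹ := by ring
  · have h := tendsto_inv_atTop_zero.const_mul
      (C * (2 + (M.factorial : ℝ)) * ∑' k : ℕ, ((k : ℝ) + 1)⁻¹ ^ 3)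
    rwa [mul_zero] at h

/-! ## The registered stub -/

/-- **STUB Z3a `stub_chainEnergy_signs` — SIGN FACTS OF A ONE-CROSSING POTENTIAL** (registered stub of
Transfer skeleton VII of line `closure-makes-nogap-exact`).  For `V(r) = −∫₀^∞ e^{−tr} p(t) dt` with `p`
measurable, `≥ 0` on `(0, t₀]`, `≤ 0` on `[t₀, ∞)` and `|p(t)| ≤ C (t² + t^M)` (`M ≥ 2`):
(i) `V ≥ −B` on `(0, ∞)` for some `B` (drop the attractive part of the density);
(ii) negativity propagates to the right — `r ↦ e^{r t₀} ∫ e^{−tr} p` is non-decreasing, so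
`V(r₁) < 0 ⇒ V(r) < 0` for all `r ≥ r₁ > 0`; hence (iii) the chain energy `Σ_k V((k+1) r₁)` at such a
spacing `r₁` is negative; and (iv) the chain energy tends to `0` at infinity
(`|Σ_k V((k+1) b)| ≤ C (2 + M!) ζ(3) b⁻¹` for `b ≥ 1`). [folklore] -/
theorem stub_chainEnergy_signs : ∀ (V p : ℝ → ℝ) (t₀ C : ℝ) (M : ℕ), Measurable p → 0 < t₀ →
    (∀ t : ℝ, 0 < t → t ≤ t₀ → 0 ≤ p t) → (∀ t : ℝ, t₀ ≤ t → p t ≤ 0) → 2 ≤ M →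
    (∀ t : ℝ, 0 < t → |p t| ≤ C * (t ^ 2 + t ^ M)) →
    (∀ r : ℝ, 0 < r → V r = -(∫ t in Set.Ioi (0 : ℝ), Real.exp (-(t * r)) * p t)) →
    (∃ B : ℝ, ∀ r : ℝ, 0 < r → -B ≤ V r) ∧
    (∀ r₁ r : ℝ, 0 < r₁ → r₁ ≤ r → V r₁ < 0 → V r < 0) ∧
    (∀ r₁ : ℝ, 0 < r₁ → V r₁ < 0 → ∑' k : ℕ, V (((k : ℝ) + 1) * r₁) < 0) ∧
    Filter.Tendsto (fun b : ℝ => ∑' k : ℕ, V (((k : ℝ) + 1) * b)) Filter.atTop (nhds 0) := by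
  intro V p t₀ C M hpm ht₀ hpos hneg hM hbd hV
  exact ⟨zsign_lower_bound hpm ht₀ hpos hneg hbd hV,
    fun r₁ r hr₁ hr hV₁ => zsign_neg_propagates hpm hpos hneg hbd hV hr₁ hr hV₁,
    fun r₁ hr₁ hV₁ => zsign_chain_neg hM hpm hpos hneg hbd hV hr₁ hV₁,
    zsign_chain_tendsto_zero hM hpm hbd hV⟩

end Summit.AtomisticToContinuum.Crystallization.Theorems.ThreeConeCertificateExactCertificate.Transfer1D

end
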